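import Literature.Topology.FourManifolds.DehnNielsenBaerFlowerMeridianTwist
import Literature.Topology.FourManifolds.FlowerSectorWord
import Literature.Geometry.Manifold.FlowPeriodicFamily
import HarnessLib

/-!
# Dehn–Nielsen–Baer on the flower surface: the orbit of the meridian twist flow is the meridian
# circle `C₁`, traversed once per minimal period, and reads `(d · u⁻¹)^{±1}` at the lens tip `P`

Topic `Literature/Topology/FourManifolds`; PROOF file of the named fact
`Literature.Topology.FourManifolds.DehnNielsenBaerSurfaceSmooth` (`DehnNielsenBaerSurface.lean`), first half of the
`π₁`-bookkeeping item W2.3-meridian (the action of the meridian Dehn twist of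
`DehnNielsenBaerFlowerMeridianTwist.exists_meridianDehnTwist` on the marking).  The twist is
`x ↦ θ(λ(y), x)` for the flow `θ` of the twist field of `H = (y, q_g ∘ π + z²)`; to read its action one
needs the closed orbit through the section point `σ(0, c_g) = Cup(r_b)` as an explicit loop of the
sector `sectorZ g`.  Here:

* §1 `FlowerModel.merC` — **the meridian circle** `C₁ = {y = 0, q_g ∘ π + z² = c_g, x ≥ 7^{1/20g}}`:
  it is the union of the two `C₁`-edges `Cup`, `Cdn` of the reduced spine over `JC = [7^{1/20g}, ρ₃]`
  (`FlowerSectorWord.lean`), connected, inside the sector, meets the plane `z = 0` exactly in the lens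
  tip `P` and the indentation point `Q`, and — the separation fact — equals
  `{y = 0, q_g ∘ π + z² = c_g} ∩ {x > r_a}` (the peak ray is outside the flower domain on `(ρ₁, 7^{1/20g})`,
  `prof_le_level_iff`), so it is relatively open and closed in the level set `{y = 0, q_g ∘ π + z² = c_g}`;
* §2 `FlowerModel.exists_delta_range_fderiv_pairH_y` — `D(y, q_g ∘ π + z²)` is onto near that level set;
* §3 for a flow `θ` on `ℝ³` preserving `H` whose velocity is the twist field cut off by a `ψ` equal to
  `1` near the level: **the orbit of `Cup(r_b)` is exactly `C₁`** (`range_orbit_eq_merC`: it stays in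
  `C₁` by the intermediate value theorem on the `x`-coordinate, and fills it because it is open —
  flow chart, `exists_equiv_hasStrictFDerivAt_of_finrank` — and closed in the level set and `C₁` is
  connected), it passes through `P`, and has a minimal period `T₀` (`exists_minimal_period`);
* §4 **reading a simple parametrisation of `C₁`**: a continuous `1`-periodic `E : ℝ → C₁` with
  `E 0 = P`, injective modulo `1` and onto `C₁`, runs from `P` to `Q` along one of the two edges and
  back along the other, so a loop at `P` parametrised through `E` over `[0, 1]` has the class of the arc
  loop `ℓ_a = loopR (0, false)` (`d · u⁻¹`, `cl_loopR_a`) or of its inverse (`cl_eq_or_of_isParamOn`);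
  §5 applies this to `u ↦ θ(u T₀, P)` (`cl_orbit_eq_or`).

Everything is proved; one definition (`merC`); no named facts (D-0026).

## References

* B. Farb, D. Margalit, *A primer on mapping class groups*, PMS 49 (2012), §3.1.1 (the twist map and
  its action on curves crossing the annulus), Thm. 8.1. [FarbMargalit2012]
* H. Zieschang, E. Vogt, H.-D. Coldewey, *Surfaces and planar discontinuous groups*, LNM 835 (1980),
  §3.2, Thm. 5.6.1–5.6.2. [ZieschangVogtColdewey1980]
* A. Hatcher, *Algebraic Topology* (2002), Example 1.22, Prop. 1.17. [HatcherAT2002]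
-/

open scoped Manifold ContDiff Topology Real unitInterval
open Set Function Filter Metric

noncomputable section

namespace Literature.Topology.FourManifolds

open PlanarThickening PlanarDouble Literature.Geometry.Manifold Literature.AlgebraicTopology.FundamentalGroup
  Literature.AlgebraicTopology.FundamentalGroup.EdgePath PlanarLevelTwist

/-- Local notation: `𝔼 n` is the model Euclidean space `EuclideanSpace ℝ (Fin n)`. -/
local notation "𝔼 " n:arg => EuclideanSpace ℝ (Fin n)

namespace FlowerModel

variable {g : ℕ}

/-! ### §1 The meridian circle `C₁` -/

/-- **The meridian circle** `C₁ = {y = 0, q_g ∘ π + z² = c_g, x ≥ 7^{1/20g}}` of the flower surface: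
the circle over the segment `[7^{1/20g}, ρ₃]` of the `x`-axis beyond the first hole.
[cite: FarbMargalit2012, §3.1.1] -/
def merC (g : ℕ) : Set (𝔼 3) := {p | p 1 = 0 ∧ thicken (flower g) p = level g ∧ rt g 7 ≤ p 0}

/-- The projection of a point of the plane `y = 0` is an axis point. [folklore] -/
theorem proj_eq_ax {p : 𝔼 3} (hp : p 1 = 0) : proj p = ax (p 0) := by
  have h := eq_ax_of_apply_one_eq_zero (p := proj p) (by simpa using hp)
  simpa using h

/-- On `C₁`, `prof(x) + z² = c`. [folklore] -/
theorem prof_add_sq_of_mem_merC {p : 𝔼 3} (hp : p ∈ merC g) : prof g (p 0) + p 2 ^ 2 = level g := by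
  have h := hp.2.1
  rwa [thicken_apply, proj_eq_ax hp.1, flower_ax'] at h

/-- On `C₁`, `prof(x) ≤ c`. [folklore] -/
theorem prof_le_of_mem_merC {p : 𝔼 3} (hp : p ∈ merC g) : prof g (p 0) ≤ level g := by
  have := prof_add_sq_of_mem_merC hp; nlinarith [sq_nonneg (p 2)]

/-- On `C₁`, `x ∈ JC = [7^{1/20g}, ρ₃]`. [folklore] -/
theorem apply_zero_mem_JC (hg : 2 ≤ g) {p : 𝔼 3} (hp : p ∈ merC g) : p 0 ∈ JC hg := by
  have h0 : 0 ≤ p 0 := le_trans (rt_pos (by norm_num)).le hp.2.2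
  rcases (prof_le_level_iff hg h0).1 (prof_le_of_mem_merC hp) with h | h
  · exact absurd (lt_of_lt_of_le (rho1_lt_rt_seven hg) hp.2.2) (not_lt.2 h)
  · exact h

/-- `C₁` lies on the flower surface. [folklore] -/
theorem merC_subset_flowerSurface : merC g ⊆ flowerSurface g := fun _ hp => hp.2.1

/-- The upper `C₁` edge over `JC` lies in `C₁`. [folklore] -/
theorem Cup_mem_merC (hg : 2 ≤ g) {r : ℝ} (hr : r ∈ JC hg) : Cup g r ∈ merC g := by
  refine ⟨by simp [Cup, upperPt], ?_, by simpa [Cup, upperPt] using hr.1⟩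
  exact upperPt_mem (flower_ax_le_of_mem_JC hg hr)

/-- The lower `C₁` edge over `JC` lies in `C₁`. [folklore] -/
theorem Cdn_mem_merC (hg : 2 ≤ g) {r : ℝ} (hr : r ∈ JC hg) : Cdn g r ∈ merC g := by
  refine ⟨by simp [Cdn, lowerPt], ?_, by simpa [Cdn, lowerPt] using hr.1⟩
  exact lowerPt_mem (flower_ax_le_of_mem_JC hg hr)

/-- A point of `C₁` with `z ≥ 0` is on the upper edge. [folklore] -/
theorem eq_Cup_of_mem_merC {p : 𝔼 3} (hp : p ∈ merC g) (hz : 0 ≤ p 2) : p = Cup g (p 0) := by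
  rw [Cup, ← proj_eq_ax hp.1]
  exact eq_upperPt_of_mem hp.2.1 hz

/-- A point of `C₁` with `z ≤ 0` is on the lower edge. [folklore] -/
theorem eq_Cdn_of_mem_merC {p : 𝔼 3} (hp : p ∈ merC g) (hz : p 2 ≤ 0) : p = Cdn g (p 0) := by
  rw [Cdn, ← proj_eq_ax hp.1]
  exact eq_lowerPt_of_mem hp.2.1 hz

/-- **`C₁` is the union of the two `C₁` edges over `JC`.** [folklore] -/
theorem merC_eq_union (hg : 2 ≤ g) : merC g = Cup g '' JC hg ∪ Cdn g '' JC hg := by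
  ext p
  constructor
  · intro hp
    rcases le_total 0 (p 2) with h | h
    · exact Or.inl ⟨p 0, apply_zero_mem_JC hg hp, (eq_Cup_of_mem_merC hp h).symm⟩
    · exact Or.inr ⟨p 0, apply_zero_mem_JC hg hp, (eq_Cdn_of_mem_merC hp h).symm⟩
  · rintro (⟨r, hr, rfl⟩ | ⟨r, hr, rfl⟩)
    · exact Cup_mem_merC hg hr
    · exact Cdn_mem_merC hg hr

/-- `C₁` lies in the sector. [folklore] -/
theorem merC_subset_sectorZ (hg : 2 ≤ g) : merC g ⊆ sectorZ g := by
  rw [merC_eq_union hg]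
  rintro p (⟨r, hr, rfl⟩ | ⟨r, hr, rfl⟩)
  · exact mapsTo_Cup hg hr
  · exact mapsTo_Cdn hg hr

/-- **`C₁` is connected** (two arcs with the common end point `P`). [folklore] -/
theorem isConnected_merC (hg : 2 ≤ g) : IsConnected (merC g) := by
  rw [merC_eq_union hg]
  have hJC : IsConnected (JC hg) := isConnected_Icc (rt_seven_lt_rho3 hg).le
  refine IsConnected.union ⟨ptP g, ?_, ?_⟩ (hJC.image _ (continuous_Cup g).continuousOn)
    (hJC.image _ (continuous_Cdn g).continuousOn)
  · exact ⟨rt g 7, rt_seven_mem_JC hg, Cup_rt_seven g⟩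
  · exact ⟨rt g 7, rt_seven_mem_JC hg, Cdn_rt_seven g⟩

/-- The lens tip `P` lies on `C₁`. [folklore] -/
theorem ptP_mem_merC (hg : 2 ≤ g) : ptP g ∈ merC g := Cup_rt_seven g ▸ Cup_mem_merC hg (rt_seven_mem_JC hg)

/-- The indentation point `Q` lies on `C₁`. [folklore] -/
theorem ptQ_mem_merC (hg : 2 ≤ g) : ptQ hg ∈ merC g := Cup_rho3 hg ▸ Cup_mem_merC hg (rho3_mem_JC hg)

/-- `P = (7^{1/20g}, 0, 0)`: coordinates. [folklore] -/
theorem ptP_apply_zero (g : ℕ) : ptP g 0 = rt g 7 := by simp [ptP]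

/-- `Q = (ρ₃, 0, 0)`: coordinates. [folklore] -/
theorem ptQ_apply_zero (hg : 2 ≤ g) : ptQ hg 0 = rho3 hg := by simp [ptQ]

/-- `P` has `z = 0`. [folklore] -/
theorem ptP_apply_two (g : ℕ) : ptP g 2 = 0 := by simp [ptP]

/-- `Q` has `z = 0`. [folklore] -/
theorem ptQ_apply_two (hg : 2 ≤ g) : ptQ hg 2 = 0 := by simp [ptQ]

/-- **Inside `JC` the peak ray is strictly inside the flower domain**: `prof r < c` for
`7^{1/20g} < r < ρ₃`. [folklore] -/
theorem prof_lt_level_of_mem_Ioo (hg : 2 ≤ g) {r : ℝ} (h1 : rt g 7 < r) (h2 : r < rho3 hg) :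
    prof g r < level g := by
  rcases le_or_gt r (rb hg) with hrb | hrb
  · rw [show level g = prof g (rt g 7) from rfl]
    exact strictAntiOn_prof hg ⟨(ra_lt_rt_seven hg).le, (rt_seven_lt_rb hg).le⟩ ⟨by linarith [ra_lt_rt_seven hg], hrb⟩ h1
  · rw [← prof_rho3 hg]
    exact strictMonoOn_prof_right hg hrb.le (rho3_mem hg).1.le h2

/-- **`C₁` meets the plane `z = 0` exactly in `P` and `Q`.** [folklore] -/
theorem apply_two_eq_zero_iff_of_mem_merC (hg : 2 ≤ g) {p : 𝔼 3} (hp : p ∈ merC g) :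
    p 2 = 0 ↔ p = ptP g ∨ p = ptQ hg := by
  constructor
  · intro hz
    have hx := apply_zero_mem_JC hg hp
    have hprof : prof g (p 0) = level g := by have := prof_add_sq_of_mem_merC hp; rw [hz] at this; simpa using this
    have hr : p 0 = rt g 7 ∨ p 0 = rho3 hg := by
      by_contra h
      push Not at h
      have := prof_lt_level_of_mem_Ioo hg (lt_of_le_of_ne hx.1 (Ne.symm h.1)) (lt_of_le_of_ne hx.2 h.2)
      linarith
    have hpC := eq_Cup_of_mem_merC hp hz.ge
    rcases hr with h | h
    · left; rw [hpC, h, Cup_rt_seven]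
    · right; rw [hpC, h, Cup_rho3]
  · rintro (rfl | rfl)
    · exact ptP_apply_two g
    · exact ptQ_apply_two hg

/-- **The separation fact**: `C₁ = {y = 0, q_g ∘ π + z² = c_g} ∩ {x > r_a}` — a point of the level set
with `x > r_a` has `prof x ≤ c`, hence `x ≥ 7^{1/20g}` (`prof > c` on `(ρ₁, 7^{1/20g}) ∋ r_a`). [folklore] -/
theorem merC_eq_inter (hg : 2 ≤ g) :
    merC g = {p : 𝔼 3 | p 1 = 0 ∧ thicken (flower g) p = level g} ∩ {p | ra hg < p 0} := by
  ext p
  constructor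
  · intro hp
    exact ⟨⟨hp.1, hp.2.1⟩, lt_of_lt_of_le (ra_lt_rt_seven hg) hp.2.2⟩
  · rintro ⟨⟨hy, ht⟩, hx⟩
    replace hx : ra hg < p 0 := hx
    refine ⟨hy, ht, ?_⟩
    have h0 : 0 ≤ p 0 := le_trans (ra_pos hg).le hx.le
    have hle : prof g (p 0) ≤ level g := by
      have h := ht
      rw [thicken_apply, proj_eq_ax hy, flower_ax'] at h
      nlinarith [sq_nonneg (p 2)]
    rcases (prof_le_level_iff hg h0).1 hle with h | h
    · linarith [(rho1_mem hg).2]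
    · exact h.1

/-- `C₁` is closed. [folklore] -/
theorem isClosed_merC (g : ℕ) : IsClosed (merC g) := by
  refine (isClosed_eq (EuclideanSpace.proj (1 : Fin 3)).continuous continuous_const).inter
    ((isClosed_eq (contDiff_thicken contDiff_flower).continuous continuous_const).inter
      (isClosed_le continuous_const (EuclideanSpace.proj (0 : Fin 3)).continuous))

/-- **`C₁` is relatively open in the level set `{y = 0, q_g ∘ π + z² = c_g}`**: there is an open set of
`ℝ³` meeting the level set in `C₁`. [folklore] -/
theorem exists_isOpen_inter_eq_merC (hg : 2 ≤ g) :
    ∃ U : Set (𝔼 3), IsOpen U ∧ {p : 𝔼 3 | p 1 = 0 ∧ thicken (flower g) p = level g} ∩ U = merC g :=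
  ⟨{p | ra hg < p 0}, isOpen_lt continuous_const (EuclideanSpace.proj (0 : Fin 3)).continuous,
    (merC_eq_inter hg).symm⟩

/-! ### §2 Regularity of `H = (y, q_g ∘ π + z²)` near the level set -/

/-- **The first integrals of the meridian twist.** `H = (y, q_g ∘ π + z²)` (reducible shorthand).
[cite: FarbMargalit2012, §3.1.1] -/
abbrev merH (g : ℕ) : 𝔼 3 → ℝ × ℝ := pairH (fun x : 𝔼 3 => x 1) (flower g)

/-- **`DH` is onto near the level set `{y = 0, q_g ∘ π + z² = c_g}`.** [folklore] -/
theorem exists_delta_range_fderiv_merH (hg : 2 ≤ g) :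
    ∃ δ : ℝ, 0 < δ ∧ ∀ x : 𝔼 3, |x 1| < δ → |thicken (flower g) x - level g| < δ →
      LinearMap.range (fderiv ℝ (merH g) x : 𝔼 3 →ₗ[ℝ] ℝ × ℝ) = ⊤ := by
  obtain ⟨δ, hδ, h⟩ := exists_delta_fderiv_flower_ax_ne_zero hg
  exact ⟨δ, hδ, fun x hy ht => range_fderiv_pairH_y_eq_top h hy ht⟩

/-- `dim ℝ³ = dim ℝ² + 1`. [folklore] -/
theorem finrank_E3_eq : Module.finrank ℝ (𝔼 3) = Module.finrank ℝ (ℝ × ℝ) + 1 := by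
  rw [finrank_euclideanSpace, Module.finrank_prod, Module.finrank_self, Fintype.card_fin]

/-- The section point of the meridian package is `Cup(r_b)`. [folklore] -/
theorem Cup_rb_eq (hg : 2 ≤ g) :
    Cup g (rb hg) = lift (ax (rb hg)) + Real.sqrt (level g - prof g (rb hg)) • ez := by
  rw [Cup, upperPt, flower_ax']

/-- `Cup(r_b)` lies on `C₁`. [folklore] -/
theorem Cup_rb_mem_merC (hg : 2 ≤ g) : Cup g (rb hg) ∈ merC g :=
  Cup_mem_merC hg ⟨(rt_seven_lt_rb hg).le, (rho3_mem hg).1.le⟩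

/-- `Cdn(r_b)` lies on `C₁`. [folklore] -/
theorem Cdn_rb_mem_merC (hg : 2 ≤ g) : Cdn g (rb hg) ∈ merC g :=
  Cdn_mem_merC hg ⟨(rt_seven_lt_rb hg).le, (rho3_mem hg).1.le⟩

/-- `Cup(r_b)` is strictly above the plane `z = 0`. [folklore] -/
theorem Cup_rb_apply_two_pos (hg : 2 ≤ g) : 0 < Cup g (rb hg) 2 := by
  rw [Cup, upperPt_apply_two, flower_ax']
  exact Real.sqrt_pos.2 (by linarith [prof_rb_lt_level hg])

/-- `Cdn(r_b)` is strictly below the plane `z = 0`. [folklore] -/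
theorem Cdn_rb_apply_two_neg (hg : 2 ≤ g) : Cdn g (rb hg) 2 < 0 := by
  rw [Cdn, lowerPt_apply_two, flower_ax', neg_lt_zero]
  exact Real.sqrt_pos.2 (by linarith [prof_rb_lt_level hg])

/-- `H = (0, c_g)` exactly on the level set `{y = 0, q_g ∘ π + z² = c_g}`. [folklore] -/
theorem merH_eq_iff {x : 𝔼 3} : merH g x = (0, level g) ↔ x 1 = 0 ∧ thicken (flower g) x = level g := by
  rw [merH, pairH_apply, Prod.mk.injEq]

/-! ### §3 The orbit of `Cup(r_b)` under an `H`-preserving flow of the twist field is `C₁` -/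

section Flow

variable {θ : ℝ × 𝔼 3 → 𝔼 3} {ψ : 𝔼 3 → ℝ} {δ : ℝ}

/-- **The orbit of `Cup(r_b)` stays in `C₁`**: along it `y = 0` and `q_g ∘ π + z² = c_g` (invariance of
`H`), and the `x`-coordinate, `r_b > r_a` at time `0`, never reaches `r_a` (there `q_g ∘ π + z² ≥
prof(r_a) > c_g`), so stays `> r_a` (intermediate value theorem). [folklore] -/
theorem orbit_mem_merC (hg : 2 ≤ g) (hθc : Continuous θ) (h0 : ∀ x, θ (0, x) = x)
    (hHinv : ∀ t x, merH g (θ (t, x)) = merH g x) (t : ℝ) : θ (t, Cup g (rb hg)) ∈ merC g := by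
  set m := Cup g (rb hg) with hm
  have hHm : merH g m = (0, level g) := merH_eq_iff.2 ⟨(Cup_rb_mem_merC hg).1, (Cup_rb_mem_merC hg).2.1⟩
  have hlev : ∀ s, θ (s, m) 1 = 0 ∧ thicken (flower g) (θ (s, m)) = level g := fun s =>
    merH_eq_iff.1 (by rw [hHinv, hHm])
  rw [merC_eq_inter hg]
  refine ⟨hlev t, ?_⟩
  show ra hg < θ (t, m) 0
  by_contra hle
  push Not at hle
  -- the `x`-coordinate along the orbit
  set X : ℝ → ℝ := fun s => θ (s, m) 0 with hX
  have hXc : Continuous X :=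
    (EuclideanSpace.proj (0 : Fin 3)).continuous.comp (hθc.comp (continuous_id.prodMk continuous_const))
  have hX0 : X 0 = rb hg := by simp [hX, h0, hm, Cup, upperPt]
  obtain ⟨s, -, hs⟩ : ra hg ∈ X '' uIcc t 0 :=
    intermediate_value_uIcc hXc.continuousOn (mem_uIcc.2 (Or.inl ⟨hle, by rw [hX0]; exact (ra_lt_rb hg).le⟩))
  -- at that time the point lies over the peak `(r_a, 0)`: impossible on the level
  have h1 : proj (θ (s, m)) = ax (ra hg) := by rw [proj_eq_ax (hlev s).1]; exact congrArg ax hs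
  have h2 : thicken (flower g) (θ (s, m)) = prof g (ra hg) + θ (s, m) 2 ^ 2 := by
    rw [thicken_apply, h1, flower_ax']
  nlinarith [(hlev s).2, level_lt_prof_ra hg, sq_nonneg (θ (s, m) 2)]

/-- **The twist field does not vanish on the level set** where the cut-off is `1` and `DH` is onto.
[folklore] -/
theorem twistField_merH_ne_zero {δr : ℝ}
    (hreg : ∀ x : 𝔼 3, |x 1| < δr → |thicken (flower g) x - level g| < δr →
      LinearMap.range (fderiv ℝ (merH g) x : 𝔼 3 →ₗ[ℝ] ℝ × ℝ) = ⊤)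
    (hδ : 0 < δ) (hδr : 0 < δr)
    (hψ1 : ∀ x, merH g x ∈ Ioo (-δ) δ ×ˢ Ioo (level g - δ) (level g + δ) → ψ x = 1)
    {x : 𝔼 3} (hy : x 1 = 0) (ht : thicken (flower g) x = level g) :
    twistField bE3 bF2 (merH g) ψ x ≠ 0 := by
  refine twistField_ne_zero ?_ (hreg x (by rw [hy, abs_zero]; exact hδr) (by rw [ht, sub_self, abs_zero]; exact hδr))
  rw [hψ1 x (by rw [merH, pairH_apply, hy, ht]; exact ⟨⟨by linarith, hδ⟩, ⟨by linarith, by linarith⟩⟩)]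
  exact one_ne_zero

/-- **The flow chart**: around each point of the orbit of `Cup(r_b)` there is an open set of `ℝ³`
whose points on the level set `{y = 0, q_g ∘ π + z² = c_g}` are on the orbit (inverse function theorem
for `(t, s) ↦ θ(t, sec s)`, `sec` the section of the package, `H ∘ sec = id` near `(0, c_g)`).
[cite: LeeSmoothManifolds2013, Thm. 9.22] -/
theorem exists_isOpen_level_subset_orbit (hg : 2 ≤ g) (hθ : ContDiff ℝ ∞ θ) (h0 : ∀ x, θ (0, x) = x)
    (hint : ∀ x t, HasDerivAt (fun t => θ (t, x)) (twistField bE3 bF2 (merH g) ψ (θ (t, x))) t)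
    (hHinv : ∀ t x, merH g (θ (t, x)) = merH g x) {δr : ℝ}
    (hreg : ∀ x : 𝔼 3, |x 1| < δr → |thicken (flower g) x - level g| < δr →
      LinearMap.range (fderiv ℝ (merH g) x : 𝔼 3 →ₗ[ℝ] ℝ × ℝ) = ⊤)
    (hδ : 0 < δ) (hδr : 0 < δr)
    (hψ1 : ∀ x, merH g x ∈ Ioo (-δ) δ ×ˢ Ioo (level g - δ) (level g + δ) → ψ x = 1)
    {sec : ℝ × ℝ → 𝔼 3} (hσs : ContDiff ℝ ∞ sec)
    (hHσ : ∀ s ∈ Ioo (-δ) δ ×ˢ Ioo (level g - δ) (level g + δ), merH g (sec s) = s)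
    (hσ0 : sec (0, level g) = Cup g (rb hg)) (u : ℝ) :
    ∃ N : Set (𝔼 3), IsOpen N ∧ θ (u, Cup g (rb hg)) ∈ N ∧
      ∀ w ∈ N, w 1 = 0 → thicken (flower g) w = level g → ∃ t, θ (t, Cup g (rb hg)) = w := by
  set s₀ : ℝ × ℝ := (0, level g) with hs₀
  set box : Set (ℝ × ℝ) := Ioo (-δ) δ ×ˢ Ioo (level g - δ) (level g + δ) with hbox
  have hbox_open : IsOpen box := (isOpen_Ioo.prod isOpen_Ioo)
  have hs₀box : s₀ ∈ box := ⟨⟨by linarith, hδ⟩, ⟨by linarith, by linarith⟩⟩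
  have hev : ∀ᶠ s' in 𝓝 s₀, merH g (sec s') = s' := by
    filter_upwards [hbox_open.mem_nhds hs₀box] with s' hs' using hHσ s' hs'
  have hmem := orbit_mem_merC hg hθ.continuous h0 hHinv u
  have hv0 : twistField bE3 bF2 (merH g) ψ (θ (u, sec s₀)) ≠ 0 := by
    rw [hσ0]
    exact twistField_merH_ne_zero hreg hδ hδr hψ1 hmem.1 hmem.2.1
  obtain ⟨L, hL⟩ := exists_equiv_hasStrictFDerivAt_of_finrank finrank_E3_eq hθ (contDiff_pairH contDiff_apply_one contDiff_flower)
    hHinv hσs hev u (hint (sec s₀) u) hv0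
  -- the image of the neighbourhood `ℝ × box` of `(u, s₀)` is a neighbourhood of `θ(u, sec s₀)`
  have hW : (univ : Set ℝ) ×ˢ box ∈ 𝓝 (u, s₀) := prod_mem_nhds univ_mem (hbox_open.mem_nhds hs₀box)
  have himg : (fun p : ℝ × (ℝ × ℝ) => θ (p.1, sec p.2)) '' ((univ : Set ℝ) ×ˢ box) ∈ 𝓝 (θ (u, sec s₀)) := by
    rw [← hL.map_nhds_eq_of_equiv]
    exact image_mem_map hW
  obtain ⟨N, hNsub, hNo, hN⟩ := _root_.mem_nhds_iff.1 himg
  refine ⟨N, hNo, by rw [← hσ0]; exact hN, fun w hw hw1 hw2 => ?_⟩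
  obtain ⟨⟨t, s⟩, ⟨-, hs⟩, rfl⟩ := hNsub hw
  have hs' : s = s₀ := by
    have h := hHinv t (sec s)
    rw [hHσ s hs] at h
    rw [← h]
    exact merH_eq_iff.2 ⟨hw1, hw2⟩
  exact ⟨t, by rw [← hσ0, ← hs']⟩

/-- **The orbit of `Cup(r_b)` is the whole meridian circle `C₁`**: it is contained in it
(`orbit_mem_merC`), closed (a period makes it the continuous image of a compact interval), relatively
open in the level set (`exists_isOpen_level_subset_orbit`), and `C₁` is connected. [folklore] -/
theorem range_orbit_eq_merC (hg : 2 ≤ g) (hθ : ContDiff ℝ ∞ θ) (h0 : ∀ x, θ (0, x) = x)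
    (hadd : ∀ t s x, θ (t, θ (s, x)) = θ (t + s, x))
    (hint : ∀ x t, HasDerivAt (fun t => θ (t, x)) (twistField bE3 bF2 (merH g) ψ (θ (t, x))) t)
    (hHinv : ∀ t x, merH g (θ (t, x)) = merH g x) {δr : ℝ}
    (hreg : ∀ x : 𝔼 3, |x 1| < δr → |thicken (flower g) x - level g| < δr →
      LinearMap.range (fderiv ℝ (merH g) x : 𝔼 3 →ₗ[ℝ] ℝ × ℝ) = ⊤)
    (hδ : 0 < δ) (hδr : 0 < δr)
    (hψ1 : ∀ x, merH g x ∈ Ioo (-δ) δ ×ˢ Ioo (level g - δ) (level g + δ) → ψ x = 1)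
    {sec : ℝ × ℝ → 𝔼 3} (hσs : ContDiff ℝ ∞ sec)
    (hHσ : ∀ s ∈ Ioo (-δ) δ ×ˢ Ioo (level g - δ) (level g + δ), merH g (sec s) = s)
    (hσ0 : sec (0, level g) = Cup g (rb hg)) (hper : ∃ T : ℝ, 0 < T ∧ θ (T, Cup g (rb hg)) = Cup g (rb hg)) :
    range (fun t => θ (t, Cup g (rb hg))) = merC g := by
  set m := Cup g (rb hg) with hm
  set O : Set (𝔼 3) := range fun t => θ (t, m) with hO
  refine Subset.antisymm (range_subset_iff.2 (orbit_mem_merC hg hθ.continuous h0 hHinv)) ?_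
  -- `O` is closed
  obtain ⟨T, hT, hTm⟩ := hper
  have hOc : IsClosed O := by
    have hOeq : O = (fun t => θ (t, m)) '' Icc 0 T := by
      refine Subset.antisymm ?_ (image_subset_range _ _)
      rintro _ ⟨t, rfl⟩
      obtain ⟨r, hr, hrt⟩ := exists_mem_Ico_apply_eq h0 hadd hT hTm t
      exact ⟨r, Ico_subset_Icc_self hr, hrt.symm⟩
    rw [hOeq]
    exact (isCompact_Icc.image (hθ.continuous.comp (continuous_id.prodMk continuous_const))).isClosed
  -- `O` is relatively open in the level set: the union `U` of the flow charts
  choose N hNo hNmem hN using exists_isOpen_level_subset_orbit hg hθ h0 hint hHinv hreg hδ hδr hψ1 hσs hHσ hσ0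
  set U : Set (𝔼 3) := ⋃ u, N u with hU
  have hUo : IsOpen U := isOpen_iUnion hNo
  have hOU : O ⊆ U := by rintro _ ⟨u, rfl⟩; exact mem_iUnion.2 ⟨u, hNmem u⟩
  have hUO : ∀ w ∈ U, w 1 = 0 → thicken (flower g) w = level g → w ∈ O := by
    intro w hw hw1 hw2
    obtain ⟨u, hu⟩ := mem_iUnion.1 hw
    obtain ⟨t, ht⟩ := hN u w hu hw1 hw2
    exact ⟨t, ht⟩
  -- connectedness
  intro p hp
  by_contra hpO
  have hpre := (isConnected_merC hg).isPreconnected U Oᶜ hUo hOc.isOpen_compl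
    (fun x hx => by by_cases h : x ∈ O; exacts [Or.inl (hOU h), Or.inr h])
    ⟨m, Cup_rb_mem_merC hg, hOU ⟨0, h0 m⟩⟩ ⟨p, hp, hpO⟩
  obtain ⟨w, hwC, hwU, hwO⟩ := hpre
  exact hwO (hUO w hwU hwC.1 hwC.2.1)

/-- **The lens tip `P` is on the orbit of `Cup(r_b)`.** [folklore] -/
theorem exists_apply_eq_ptP (hg : 2 ≤ g) (hθ : ContDiff ℝ ∞ θ) (h0 : ∀ x, θ (0, x) = x)
    (hadd : ∀ t s x, θ (t, θ (s, x)) = θ (t + s, x))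
    (hint : ∀ x t, HasDerivAt (fun t => θ (t, x)) (twistField bE3 bF2 (merH g) ψ (θ (t, x))) t)
    (hHinv : ∀ t x, merH g (θ (t, x)) = merH g x) {δr : ℝ}
    (hreg : ∀ x : 𝔼 3, |x 1| < δr → |thicken (flower g) x - level g| < δr →
      LinearMap.range (fderiv ℝ (merH g) x : 𝔼 3 →ₗ[ℝ] ℝ × ℝ) = ⊤)
    (hδ : 0 < δ) (hδr : 0 < δr)
    (hψ1 : ∀ x, merH g x ∈ Ioo (-δ) δ ×ˢ Ioo (level g - δ) (level g + δ) → ψ x = 1)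
    {sec : ℝ × ℝ → 𝔼 3} (hσs : ContDiff ℝ ∞ sec)
    (hHσ : ∀ s ∈ Ioo (-δ) δ ×ˢ Ioo (level g - δ) (level g + δ), merH g (sec s) = s)
    (hσ0 : sec (0, level g) = Cup g (rb hg)) (hper : ∃ T : ℝ, 0 < T ∧ θ (T, Cup g (rb hg)) = Cup g (rb hg)) :
    ∃ u : ℝ, θ (u, Cup g (rb hg)) = ptP g := by
  have h := range_orbit_eq_merC hg hθ h0 hadd hint hHinv hreg hδ hδr hψ1 hσs hHσ hσ0 hper
  have hP : ptP g ∈ range fun t => θ (t, Cup g (rb hg)) := by rw [h]; exact ptP_mem_merC hg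
  exact hP

/-- `P ≠ Cup(r_b)` (`P` is on the plane `z = 0`, `Cup(r_b)` above it). [folklore] -/
theorem ptP_ne_Cup_rb (hg : 2 ≤ g) : ptP g ≠ Cup g (rb hg) := fun h => by
  have := Cup_rb_apply_two_pos hg
  rw [← h, ptP_apply_two] at this
  exact lt_irrefl _ this

end Flow

/-! ### §4 Reading a simple closed parametrisation of `C₁` -/

/-- `Q ≠ P`. [folklore] -/
theorem ptQ_ne_ptP (hg : 2 ≤ g) : ptQ hg ≠ ptP g := fun h => by
  have := congrArg (fun p : 𝔼 3 => p 0) h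
  simp only [ptQ_apply_zero, ptP_apply_zero] at this
  linarith [rt_seven_lt_rho3 hg]

/-- **No sign change without a zero** (intermediate value theorem). [folklore] -/
theorem false_of_sign_change {f : ℝ → ℝ} (hf : Continuous f) {a b : ℝ} (hz : ∀ w ∈ Ioo a b, f w ≠ 0)
    {u u' : ℝ} (hu : u ∈ Ioo a b) (hu' : u' ∈ Ioo a b) (h1 : f u < 0) (h2 : 0 < f u') : False := by
  obtain ⟨w, hw, hw0⟩ : (0 : ℝ) ∈ f '' uIcc u u' :=
    intermediate_value_uIcc hf.continuousOn (mem_uIcc.2 (Or.inl ⟨h1.le, h2.le⟩))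
  exact hz w (ordConnected_Ioo.uIcc_subset hu hu' hw) hw0

/-- **A continuous function without zeros on an open interval has a constant sign there.** [folklore] -/
theorem forall_pos_or_forall_neg {f : ℝ → ℝ} (hf : Continuous f) {a b : ℝ} (hab : a < b)
    (hz : ∀ w ∈ Ioo a b, f w ≠ 0) : (∀ w ∈ Ioo a b, 0 < f w) ∨ (∀ w ∈ Ioo a b, f w < 0) := by
  have hmid : (a + b) / 2 ∈ Ioo a b := ⟨by linarith, by linarith⟩
  rcases lt_or_gt_of_ne (hz _ hmid) with h | h
  · refine Or.inr fun w hw => ?_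
    rcases lt_or_gt_of_ne (hz w hw) with h' | h'
    · exact h'
    · exact absurd h' fun h' => false_of_sign_change hf hz hmid hw h h'
  · refine Or.inl fun w hw => ?_
    rcases lt_or_gt_of_ne (hz w hw) with h' | h'
    · exact absurd h' fun h' => false_of_sign_change hf hz hw hmid h' h
    · exact h'

section Reading

variable {E : ℝ → 𝔼 3}

/-- A `1`-periodic map takes the same value at `u` and at its fractional part. [folklore] -/
theorem apply_fract_eq (hEper : ∀ (u : ℝ) (n : ℤ), E (u + n) = E u) (u : ℝ) : E (Int.fract u) = E u := by
  have h := hEper u (-⌊u⌋)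
  rw [Int.cast_neg, ← sub_eq_add_neg] at h
  exact h

/-- **The parameter of `Q`**: a continuous `1`-periodic parametrisation of `C₁` from `P`, onto `C₁`,
passes through `Q` at some parameter in `(0, 1)`. [folklore] -/
theorem exists_uQ (hg : 2 ≤ g) (hE0 : E 0 = ptP g) (hEper : ∀ (u : ℝ) (n : ℤ), E (u + n) = E u)
    (hEsurj : merC g ⊆ range E) : ∃ uQ ∈ Ioo (0 : ℝ) 1, E uQ = ptQ hg := by
  obtain ⟨v, hv⟩ := hEsurj (ptQ_mem_merC hg)
  refine ⟨Int.fract v, ⟨lt_of_le_of_ne (Int.fract_nonneg v) ?_, Int.fract_lt_one v⟩, by rw [apply_fract_eq hEper, hv]⟩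
  intro h0
  have : E (Int.fract v) = ptQ hg := by rw [apply_fract_eq hEper, hv]
  rw [← h0, hE0] at this
  exact ptQ_ne_ptP hg this.symm

/-- **The zeros of `z` along one period**: on `[0, 1]`, `z(E u) = 0` exactly at `0`, `u_Q`, `1`
(injectivity modulo `1`). [folklore] -/
theorem apply_two_eq_zero_iff_mem (hg : 2 ≤ g) (hE0 : E 0 = ptP g) (hEmem : ∀ u, E u ∈ merC g)
    (hEper : ∀ (u : ℝ) (n : ℤ), E (u + n) = E u) (hEinj : ∀ u v, E u = E v → ∃ n : ℤ, v = u + n)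
    {uQ : ℝ} (huQ : uQ ∈ Ioo (0 : ℝ) 1) (hEuQ : E uQ = ptQ hg) {u : ℝ} (hu : u ∈ Icc (0 : ℝ) 1) :
    E u 2 = 0 ↔ u = 0 ∨ u = uQ ∨ u = 1 := by
  have hE1 : E 1 = ptP g := by have := hEper 0 1; rw [zero_add, Int.cast_one] at this; rw [this, hE0]
  constructor
  · intro hz
    rcases (apply_two_eq_zero_iff_of_mem_merC hg (hEmem u)).1 hz with h | h
    · obtain ⟨n, hn⟩ := hEinj 0 u (by rw [hE0, h])
      rw [zero_add] at hn
      have h0n : (0 : ℤ) ≤ n := by have : (0 : ℝ) ≤ n := hn ▸ hu.1; exact_mod_cast this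
      have hn1 : n ≤ (1 : ℤ) := by have : (n : ℝ) ≤ 1 := hn ▸ hu.2; exact_mod_cast this
      rcases (show n = 0 ∨ n = 1 by omega) with rfl | rfl
      · left; rw [hn, Int.cast_zero]
      · right; right; rw [hn, Int.cast_one]
    · obtain ⟨n, hn⟩ := hEinj uQ u (by rw [hEuQ, h])
      have h1 : (-1 : ℝ) < n := by linarith [hu.1, huQ.2]
      have h2 : (n : ℝ) < 1 := by linarith [hu.2, huQ.1]
      have hn0 : n = 0 := by
        have h1' : (-1 : ℤ) < n := by exact_mod_cast h1
        have h2' : n < (1 : ℤ) := by exact_mod_cast h2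
        omega
      right; left; rw [hn, hn0, Int.cast_zero, add_zero]
  · rintro (rfl | rfl | rfl)
    · rw [hE0]; exact ptP_apply_two g
    · rw [hEuQ]; exact ptQ_apply_two hg
    · rw [hE1]; exact ptP_apply_two g

/-- **The two runs of a simple parametrisation of `C₁`**: from `P` to `Q` along one edge, back along
the other — `z ≤ 0` on `[0, u_Q]` and `z ≥ 0` on `[u_Q, 1]`, or the other way round. [folklore] -/
theorem runs_of_simple (hg : 2 ≤ g) (hEc : Continuous E) (hE0 : E 0 = ptP g) (hEmem : ∀ u, E u ∈ merC g)
    (hEper : ∀ (u : ℝ) (n : ℤ), E (u + n) = E u) (hEinj : ∀ u v, E u = E v → ∃ n : ℤ, v = u + n)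
    (hEsurj : merC g ⊆ range E) {uQ : ℝ} (huQ : uQ ∈ Ioo (0 : ℝ) 1) (hEuQ : E uQ = ptQ hg) :
    ((∀ u ∈ Icc 0 uQ, E u 2 ≤ 0) ∧ ∀ u ∈ Icc uQ 1, 0 ≤ E u 2) ∨
      ((∀ u ∈ Icc 0 uQ, 0 ≤ E u 2) ∧ ∀ u ∈ Icc uQ 1, E u 2 ≤ 0) := by
  have hzc : Continuous fun u => E u 2 := (EuclideanSpace.proj (2 : Fin 3)).continuous.comp hEc
  have hzero := fun u (hu : u ∈ Icc (0 : ℝ) 1) => apply_two_eq_zero_iff_mem hg hE0 hEmem hEper hEinj huQ hEuQ hu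
  have hzL : ∀ w ∈ Ioo 0 uQ, E w 2 ≠ 0 := fun w hw h => by
    rcases (hzero w ⟨hw.1.le, hw.2.le.trans huQ.2.le⟩).1 h with h' | h' | h' <;>
      [linarith [hw.1]; linarith [hw.2]; linarith [hw.2, huQ.2]]
  have hzR : ∀ w ∈ Ioo uQ 1, E w 2 ≠ 0 := fun w hw h => by
    rcases (hzero w ⟨huQ.1.le.trans hw.1.le, hw.2.le⟩).1 h with h' | h' | h' <;>
      [linarith [hw.1, huQ.1]; linarith [hw.1]; linarith [hw.2]]
  have hL := forall_pos_or_forall_neg hzc huQ.1 hzL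
  have hR := forall_pos_or_forall_neg hzc huQ.2 hzR
  -- closed-interval forms
  have closeL : ∀ {P : ℝ → Prop}, (∀ w ∈ Ioo 0 uQ, P (E w 2)) → P 0 → ∀ u ∈ Icc 0 uQ, P (E u 2) := by
    intro P hP hP0 u hu
    rcases hu.1.eq_or_lt with h | h
    · rw [← h, hE0, ptP_apply_two]; exact hP0
    rcases hu.2.lt_or_eq with h' | h'
    · exact hP u ⟨h, h'⟩
    · rw [h', hEuQ, ptQ_apply_two]; exact hP0
  have hE1 : E 1 = ptP g := by have := hEper 0 1; rw [zero_add, Int.cast_one] at this; rw [this, hE0]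
  have closeR : ∀ {P : ℝ → Prop}, (∀ w ∈ Ioo uQ 1, P (E w 2)) → P 0 → ∀ u ∈ Icc uQ 1, P (E u 2) := by
    intro P hP hP0 u hu
    rcases hu.1.eq_or_lt with h | h
    · rw [← h, hEuQ, ptQ_apply_two]; exact hP0
    rcases hu.2.lt_or_eq with h' | h'
    · exact hP u ⟨h, h'⟩
    · rw [h', hE1, ptP_apply_two]; exact hP0
  -- all four sign combinations; the two monotone ones contradict surjectivity
  have hall : ∀ {P : ℝ → Prop}, (∀ u ∈ Icc 0 uQ, P (E u 2)) → (∀ u ∈ Icc uQ 1, P (E u 2)) → ∀ u, P (E u 2) := by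
    intro P h1 h2 u
    rw [← apply_fract_eq hEper u]
    rcases le_total (Int.fract u) uQ with h | h
    · exact h1 _ ⟨Int.fract_nonneg u, h⟩
    · exact h2 _ ⟨h, (Int.fract_lt_one u).le⟩
  rcases hL with hL | hL <;> rcases hR with hR | hR
  · exfalso
    have h := hall (P := fun x => 0 ≤ x) (closeL (P := fun x => 0 ≤ x) (fun w hw => (hL w hw).le) le_rfl)
      (closeR (P := fun x => 0 ≤ x) (fun w hw => (hR w hw).le) le_rfl)
    obtain ⟨v, hv⟩ := hEsurj (Cdn_rb_mem_merC hg)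
    have := h v
    rw [hv] at this
    linarith [Cdn_rb_apply_two_neg hg]
  · exact Or.inr ⟨closeL (P := fun x => 0 ≤ x) (fun w hw => (hL w hw).le) le_rfl,
      closeR (P := fun x => x ≤ 0) (fun w hw => (hR w hw).le) le_rfl⟩
  · exact Or.inl ⟨closeL (P := fun x => x ≤ 0) (fun w hw => (hL w hw).le) le_rfl,
      closeR (P := fun x => 0 ≤ x) (fun w hw => (hR w hw).le) le_rfl⟩
  · exfalso
    have h := hall (P := fun x => x ≤ 0) (closeL (P := fun x => x ≤ 0) (fun w hw => (hL w hw).le) le_rfl)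
      (closeR (P := fun x => x ≤ 0) (fun w hw => (hR w hw).le) le_rfl)
    obtain ⟨v, hv⟩ := hEsurj (Cup_rb_mem_merC hg)
    have := h v
    rw [hv] at this
    linarith [Cup_rb_apply_two_pos hg]

/-- **Reading a simple closed parametrisation of `C₁`.**  Let `E : ℝ → C₁` be continuous,
`1`-periodic, injective modulo `1`, onto `C₁`, with `E 0 = P`.  Then every loop at `P` inside the
sector parametrised through `E` over `[0, 1]` from `0` to `1` has the class of the arc loop
`ℓ_a = loopR (0, false)` or of its inverse: it runs down one `C₁` edge to `Q` and back up the other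
(`runs_of_simple`), i.e. reads `d · u⁻¹` or `u · d⁻¹` (`cl_eq_atomD`, `cl_eq_atomU`, `cl_loopR_a`).
[cite: HatcherAT2002, Example 1.22] -/
theorem cl_eq_or_of_isParamOn (hg : 2 ≤ g) (hEc : Continuous E) (hE0 : E 0 = ptP g)
    (hEmem : ∀ u, E u ∈ merC g) (hEper : ∀ (u : ℝ) (n : ℤ), E (u + n) = E u)
    (hEinj : ∀ u v, E u = E v → ∃ n : ℤ, v = u + n) (hEsurj : merC g ⊆ range E)
    (p : Path (ptP g) (ptP g)) (hp : ∀ t, p t ∈ sectorZ g) (hpar : IsParamOn E (Icc 0 1) p 0 1) :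
    cl p hp = cl (loopR hg (0, false)) (loopR_mem_sectorZ hg (0, false)) ∨
      cl p hp = (cl (loopR hg (0, false)) (loopR_mem_sectorZ hg (0, false))).symm := by
  obtain ⟨uQ, huQ, hEuQ⟩ := exists_uQ hg hE0 hEper hEsurj
  have hE1 : E 1 = ptP g := by have := hEper 0 1; rw [zero_add, Int.cast_one] at this; rw [this, hE0]
  set EC : C(ℝ, 𝔼 3) := ⟨E, hEc⟩ with hEC
  have hmaps : MapsTo EC (Icc 0 1) (sectorZ g) := fun u _ => merC_subset_sectorZ hg (hEmem u)
  have h0m : (0 : ℝ) ∈ Icc (0 : ℝ) 1 := ⟨le_rfl, zero_le_one⟩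
  have h1m : (1 : ℝ) ∈ Icc (0 : ℝ) 1 := ⟨zero_le_one, le_rfl⟩
  have hQm : uQ ∈ Icc (0 : ℝ) 1 := ⟨huQ.1.le, huQ.2.le⟩
  -- the two runs
  set p₁ : Path (EC 0) (EC uQ) := epath EC 0 uQ with hp₁
  set p₂ : Path (EC uQ) (EC 1) := epath EC uQ 1 with hp₂
  have hp₁mem : ∀ t, p₁ t ∈ sectorZ g := fun t => epath_mem (convex_Icc 0 1) hmaps h0m hQm t
  have hp₂mem : ∀ t, p₂ t ∈ sectorZ g := fun t => epath_mem (convex_Icc 0 1) hmaps hQm h1m t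
  have hp₁C : ∀ t, p₁ t ∈ merC g := fun t => hEmem _
  have hp₂C : ∀ t, p₂ t ∈ merC g := fun t => hEmem _
  have h12par : IsParamOn EC (Icc 0 1) (p₁.trans p₂) 0 1 :=
    (isParamOn_epath EC (convex_Icc 0 1) h0m hQm).trans (isParamOn_epath EC (convex_Icc 0 1) hQm h1m)
  have h12mem : ∀ t, (p₁.trans p₂) t ∈ sectorZ g := VanKampen.trans_mem hp₁mem hp₂mem
  -- `p` is the concatenation of the two runs, up to homotopy inside the sector
  have hpcl : cl p hp = (cl (p₁.trans p₂) h12mem).cast (Subtype.ext hE0.symm) (Subtype.ext hE1.symm) :=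
    cl_eq_cast_of_isParamOn EC (convex_Icc 0 1) hmaps hp hpar _ h12mem h12par hE0.symm hE1.symm
  rw [hpcl, cl_trans_split]
  -- parameters of the runs
  have hpar₁t : ∀ t : I, (0 : ℝ) + (uQ - 0) * t ∈ Icc 0 uQ := fun t =>
    ⟨by nlinarith [huQ.1, t.2.1], by nlinarith [huQ.1, t.2.2]⟩
  have hpar₂t : ∀ t : I, uQ + (1 - uQ) * t ∈ Icc uQ 1 := fun t =>
    ⟨by nlinarith [huQ.2, t.2.1], by nlinarith [huQ.2, t.2.2]⟩
  have hφ₁c : Continuous fun t : I => (p₁ t) 0 := (EuclideanSpace.proj (0 : Fin 3)).continuous.comp p₁.continuous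
  have hφ₂c : Continuous fun t : I => (p₂ t) 0 := (EuclideanSpace.proj (0 : Fin 3)).continuous.comp p₂.continuous
  have hφ₁0 : (p₁ 0) 0 = rt g 7 := by rw [p₁.source]; show E 0 0 = rt g 7; rw [hE0, ptP_apply_zero]
  have hφ₁1 : (p₁ 1) 0 = rho3 hg := by rw [p₁.target]; show E uQ 0 = rho3 hg; rw [hEuQ, ptQ_apply_zero]
  have hφ₂0 : (p₂ 0) 0 = rho3 hg := by rw [p₂.source]; show E uQ 0 = rho3 hg; rw [hEuQ, ptQ_apply_zero]
  have hφ₂1 : (p₂ 1) 0 = rt g 7 := by rw [p₂.target]; show E 1 0 = rt g 7; rw [hE1, ptP_apply_zero]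
  rcases runs_of_simple hg hEc hE0 hEmem hEper hEinj hEsurj huQ hEuQ with ⟨hL, hR⟩ | ⟨hL, hR⟩
  · -- down the lower edge, back up the upper edge: `d · u⁻¹ = ℓ_a`
    left
    have hpar₁ : IsParamOn (CdnC g) (JC hg) p₁ (rt g 7) (rho3 hg) :=
      isParamOn_of_forall (fun t => (p₁ t) 0) hφ₁c (fun t => apply_zero_mem_JC hg (hp₁C t))
        (fun t => by rw [CdnC_apply]; exact eq_Cdn_of_mem_merC (hp₁C t) (hL _ (hpar₁t t))) hφ₁0 hφ₁1
    have hpar₂ : IsParamOn (CupC g) (JC hg) p₂ (rho3 hg) (rt g 7) :=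
      isParamOn_of_forall (fun t => (p₂ t) 0) hφ₂c (fun t => apply_zero_mem_JC hg (hp₂C t))
        (fun t => by rw [CupC_apply]; exact eq_Cup_of_mem_merC (hp₂C t) (hR _ (hpar₂t t))) hφ₂0 hφ₂1
    rw [cl_eq_atomD hg hp₁mem hpar₁ hE0 hEuQ, cl_eq_atomU_symm hg hp₂mem hpar₂ hEuQ hE1, cl_loopR_a]
    simp only [cast_trans_cast, Path.Homotopic.Quotient.cast_cast, cast_eq_self]
  · -- up the upper edge, back down the lower edge: `u · d⁻¹ = ℓ_a⁻¹`
    right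
    have hpar₁ : IsParamOn (CupC g) (JC hg) p₁ (rt g 7) (rho3 hg) :=
      isParamOn_of_forall (fun t => (p₁ t) 0) hφ₁c (fun t => apply_zero_mem_JC hg (hp₁C t))
        (fun t => by rw [CupC_apply]; exact eq_Cup_of_mem_merC (hp₁C t) (hL _ (hpar₁t t))) hφ₁0 hφ₁1
    have hpar₂ : IsParamOn (CdnC g) (JC hg) p₂ (rho3 hg) (rt g 7) :=
      isParamOn_of_forall (fun t => (p₂ t) 0) hφ₂c (fun t => apply_zero_mem_JC hg (hp₂C t))
        (fun t => by rw [CdnC_apply]; exact eq_Cdn_of_mem_merC (hp₂C t) (hR _ (hpar₂t t))) hφ₂0 hφ₂1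
    rw [cl_eq_atomU hg hp₁mem hpar₁ hE0 hEuQ, cl_eq_atomD_symm hg hp₂mem hpar₂ hEuQ hE1, cl_loopR_a,
      quot_symm_trans, quot_symm_symm]
    simp only [cast_trans_cast, Path.Homotopic.Quotient.cast_cast, cast_eq_self]

end Reading

/-! ### §5 The orbit loop of the meridian twist flow at `P` -/

section OrbitLoop

variable {θ : ℝ × 𝔼 3 → 𝔼 3} {ψ : 𝔼 3 → ℝ} {δ : ℝ}

/-- **The meridian orbit package.**  For an `H`-preserving smooth flow `θ` of the twist field (cut
off by `ψ = 1` near the level) with a closed orbit through the section point `Cup(r_b)`: the orbit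
passes through the lens tip `P` (`θ(u_P, Cup(r_b)) = P`), has a minimal period `T₀ > 0` (the periods
of `P` are exactly `ℤ T₀`), lies in `C₁`, and **every loop at `P` inside the sector parametrised
through `u ↦ θ(u T₀, P)` over `[0, 1]` has the class of the arc loop `ℓ_a = loopR (0, false)` or of
its inverse** (`cl_eq_or_of_isParamOn`: one turn of the meridian circle).
[cite: FarbMargalit2012, §3.1.1] [cite: HatcherAT2002, Example 1.22] -/
theorem exists_meridianOrbit (hg : 2 ≤ g) (hθ : ContDiff ℝ ∞ θ) (h0 : ∀ x, θ (0, x) = x)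
    (hadd : ∀ t s x, θ (t, θ (s, x)) = θ (t + s, x))
    (hint : ∀ x t, HasDerivAt (fun t => θ (t, x)) (twistField bE3 bF2 (merH g) ψ (θ (t, x))) t)
    (hHinv : ∀ t x, merH g (θ (t, x)) = merH g x) {δr : ℝ}
    (hreg : ∀ x : 𝔼 3, |x 1| < δr → |thicken (flower g) x - level g| < δr →
      LinearMap.range (fderiv ℝ (merH g) x : 𝔼 3 →ₗ[ℝ] ℝ × ℝ) = ⊤)
    (hδ : 0 < δ) (hδr : 0 < δr)
    (hψ1 : ∀ x, merH g x ∈ Ioo (-δ) δ ×ˢ Ioo (level g - δ) (level g + δ) → ψ x = 1)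
    {sec : ℝ × ℝ → 𝔼 3} (hσs : ContDiff ℝ ∞ sec)
    (hHσ : ∀ s ∈ Ioo (-δ) δ ×ˢ Ioo (level g - δ) (level g + δ), merH g (sec s) = s)
    (hσ0 : sec (0, level g) = Cup g (rb hg)) (hper : ∃ T : ℝ, 0 < T ∧ θ (T, Cup g (rb hg)) = Cup g (rb hg)) :
    ∃ uP T₀ : ℝ, θ (uP, Cup g (rb hg)) = ptP g ∧ 0 < T₀ ∧ θ (T₀, Cup g (rb hg)) = Cup g (rb hg) ∧
      θ (T₀, ptP g) = ptP g ∧ (∀ t, θ (t, ptP g) = ptP g ↔ ∃ n : ℤ, t = n * T₀) ∧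
      (∀ t, θ (t, ptP g) ∈ merC g) ∧
      ∀ (p : Path (ptP g) (ptP g)) (hp : ∀ t, p t ∈ sectorZ g),
        IsParamOn (fun u => θ (u * T₀, ptP g)) (Icc 0 1) p 0 1 →
        cl p hp = cl (loopR hg (0, false)) (loopR_mem_sectorZ hg (0, false)) ∨
          cl p hp = (cl (loopR hg (0, false)) (loopR_mem_sectorZ hg (0, false))).symm := by
  set m := Cup g (rb hg) with hm
  obtain ⟨uP, huP⟩ := exists_apply_eq_ptP hg hθ h0 hadd hint hHinv hreg hδ hδr hψ1 hσs hHσ hσ0 hper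
  obtain ⟨T, hT, hTm⟩ := hper
  obtain ⟨T₀, hT₀, hT₀m, hmin⟩ := exists_minimal_period hθ.continuous h0 hadd hT hTm
    ⟨uP, by rw [huP]; exact ptP_ne_Cup_rb hg⟩
  -- periods of `P` are the periods of `m`
  have hshift : ∀ t, θ (t, ptP g) = θ (uP, θ (t, m)) := fun t => by
    rw [← huP, hadd, hadd, add_comm]
  have hinjuP : ∀ x y, θ (uP, x) = θ (uP, y) → x = y := fun x y h => by
    have := congrArg (fun z => θ (-uP, z)) h
    simpa only [hadd, neg_add_cancel, h0] using this
  have hperP : ∀ t, θ (t, ptP g) = ptP g ↔ ∃ n : ℤ, t = n * T₀ := fun t => by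
    rw [← hmin t, hshift t]
    conv_lhs => rw [← huP]
    exact ⟨hinjuP _ _, fun h => by rw [h]⟩
  have hPmem : ∀ t, θ (t, ptP g) ∈ merC g := fun t => by
    rw [← huP, hadd]; exact orbit_mem_merC hg hθ.continuous h0 hHinv _
  refine ⟨uP, T₀, huP, hT₀, hT₀m, (hperP T₀).2 ⟨1, by simp⟩, hperP, hPmem, fun p hp hpar => ?_⟩
  -- the hypotheses of the reading theorem for `E u = θ(u T₀, P)`
  have hEc : Continuous fun u : ℝ => θ (u * T₀, ptP g) :=
    hθ.continuous.comp ((continuous_id.mul continuous_const).prodMk continuous_const)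
  have hE0 : θ (0 * T₀, ptP g) = ptP g := by rw [zero_mul, h0]
  have hEper : ∀ (u : ℝ) (n : ℤ), θ ((u + n) * T₀, ptP g) = θ (u * T₀, ptP g) := fun u n => by
    rw [add_mul, ← hadd, (hperP (n * T₀)).2 ⟨n, rfl⟩]
  have hEinj : ∀ u v, θ (u * T₀, ptP g) = θ (v * T₀, ptP g) → ∃ n : ℤ, v = u + n := fun u v h => by
    have h' : θ ((v - u) * T₀, ptP g) = ptP g := by
      have := congrArg (fun z => θ (-(u * T₀), z)) h
      simp only [hadd, neg_add_cancel, h0] at this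
      rw [sub_mul, sub_eq_neg_add, ← this]
    obtain ⟨n, hn⟩ := (hperP _).1 h'
    refine ⟨n, ?_⟩
    have : v - u = n := mul_right_cancel₀ hT₀.ne' hn
    linarith
  have hEsurj : merC g ⊆ range fun u : ℝ => θ (u * T₀, ptP g) := by
    intro q hq
    rw [← range_orbit_eq_merC hg hθ h0 hadd hint hHinv hreg hδ hδr hψ1 hσs hHσ hσ0 ⟨T, hT, hTm⟩] at hq
    obtain ⟨t, rfl⟩ := hq
    refine ⟨(t - uP) / T₀, ?_⟩
    show θ ((t - uP) / T₀ * T₀, ptP g) = θ (t, m)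
    rw [div_mul_cancel₀ _ hT₀.ne', ← huP, hadd, sub_add_cancel]
  exact cl_eq_or_of_isParamOn hg hEc hE0 (fun u => hPmem (u * T₀)) hEper hEinj hEsurj p hp hpar

end OrbitLoop

end FlowerModel

end Literature.Topology.FourManifolds

end
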